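import Literature.NumberTheory.DiophantineGeometry.NamedHypothesesRHProofs
import Literature.NumberTheory.LFunctions.ZetaZerosProofs
import Literature.NumberTheory.LFunctions.LevinsonMontgomery
import Literature.Barriers.RiemannHypothesis.BohrDenseValuesVoronin
import HarnessLib

/-!
# Splittings — zd neg lens: `FIN` AS A VALUE LIBRARY — fixed-window Rouché comparability of ζ-patches is FALSE (FIN-free, by
# the tree's Voronin universality); half-height comparability SPLITS RH with `FIN` by descent (SPLIT-zd-neg gen 8)

Cell rh-split, seat rh-split-zd-neg g8 (brief sha16 f79c5f09d8bcb036), card `run/shared/lean/pub/rh-split/cards/SPLIT-zd-neg.md` (GEN-8 addendum,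
rows N57, N58, N61a); def-carrying carve of the scratch kernel `HOME/rh-split-zd-neg/SketchG8.lean` (sha16 4cb1b7c2c8253a3c) §§0–2, §4, §7,
§5-N61a (lead g3 RULING #36, lane (x-b)).  `FIN` is spelled `riemannHypothesisUpTo_platt_trudgian` (`= RiemannHypothesisUpTo 3000175332800`,
named fact rh.S35).  HONEST LABEL: «SPLITTING SEARCH over kernel-typed RH-EQUIVALENCES; a splitting A ∧ B ⟹ RH is CONDITIONAL bookkeeping
unless A and B are both proved; nothing here bears on the truth of RH.»

Frame `RH ⟸ FIN ∧ (right half-strip zero-free above H₀)` (left half by the reflection `1 − conj s`, §0).  Besides its zero COUNT,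
`RiemannHypothesisUpTo W` certifies VALUES: every ζ-PATCH `patch τ s = ζ(s + 3/4 + iτ)` with heights in `(0, W]` is a zero-free holomorphic
function on the Voronin discs `|s| ≤ r < 1/4`, and a maximum-modulus COMPARISON `‖ζ_{t₀} − ζ_τ‖ < ‖ζ_τ‖` on a circle transfers
zero-freeness from the reference patch to the high one (§2, `forall_ne_zero_of_norm_sub_lt_norm`).
* §3 — FIXED WINDOW, FALSE for every onset `H` and window `W`, NO hypothesis: `not_roucheFixedLow` (reference dominant: the window's
  values at one circle point are bounded by `M`; universality gives patches near the constant `2M + 2`) and `not_roucheFixedHigh` (high patch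
  dominant: NO patch vanishes on a whole circle — maximum modulus + identity theorem + `ζ ≠ 0` on `Re ≥ 1` — so the compact window has a
  uniform circle size `m > 0`; universality gives patches near the constant `m/4`).
* §4 — HALF HEIGHT (reference at height `≤ t₀/2`, the library co-grows): `rh_of_fin_of_roucheHalfLow : FIN → RoucheHalfLow H₀ → RH` by
  DESCENT through the value-free law `HalfTransfer` (induction over heights `≤ 2^k·H₀`, base = `FIN`, step = one comparison whose
  certificate IS the induction hypothesis); `halfTransfer_iff_rh` (given `FIN` the value-free law is RH-equivalent, immune); the value-level
  tail is neither refuted nor known RH-implied (banked residue, see the card).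
NOT here (scratch kernel only): the sup-norm tail, the symmetric (Glicksberg) form, the unit-step variants and `StepTransfer`, the FIN-free
non-vacuity witnesses of the half-height tail (`roucheHalfLow_witnesses`), the record-type negation targets.
Sources: Voronin 1975; Steuding LNM 1877 Thm 1.7–1.9, §8.1, §9.1 (tree fact `Voronin1975_universality` + `_holds`); Conway V.3.8.

FILING DELTA (rh-split-typer-2 g4): the seat's helper `re_mem_Ioo_of_zero` is dropped (gate dedup: it restates the landed
`Literature.NumberTheory.LFunctions.re_mem_Ioo_of_riemannZeta_eq_zero_of_im_ne_zero`, ZetaZerosProofs.lean), its one use site now cites that lemma.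
-/

set_option linter.dupNamespace false

noncomputable section

open Filter Complex Set Metric
open scoped Real Topology
open Literature.NumberTheory.DiophantineGeometry Literature.NumberTheory.LFunctions
open Literature.Barriers.RiemannHypothesis

namespace Summit.RiemannHypothesis.RiemannHypothesis.Theorems.Splittings.ZdValueLibrary

/-! ## §0 Frame: the right half-strip above `H` -/

/-- `ZeroFreeRightUpTo T`: no zero `σ + it` with `1/2 < σ < 1`, `0 < t ≤ T` — the right-half-strip content of
`RiemannHypothesisUpTo T`. -/
def ZeroFreeRightUpTo (T : ℝ) : Prop :=
  ∀ σ t : ℝ, 1 / 2 < σ → σ < 1 → 0 < t → t ≤ T → riemannZeta (σ + t * I) ≠ 0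

/-- `RiemannHypothesisUpTo T` gives the right half-strip zero-free up to `T`. -/
theorem zeroFreeRightUpTo_of_rhUpTo {T : ℝ} (h : RiemannHypothesisUpTo T) : ZeroFreeRightUpTo T := by
  intro σ t h1 _ ht htT hz
  have := h _ hz (by simpa using ht) (by simpa using htT)
  simp at this; linarith

/-- RH up to `H` and the right half-strip `1/2 < σ < 1` zero-free above height `H` give RH (the left half `0 < σ < 1/2` by the
reflection `s ↦ 1 − conj s`, tree `LevinsonMontgomery.riemannZeta_one_sub_eq_zero` + Mathlib `riemannZeta_conj`). -/
theorem rh_of_rhUpTo_of_zeroFreeRight {H : ℝ} (hA : RiemannHypothesisUpTo H)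
    (hB : ∀ σ t : ℝ, 1 / 2 < σ → σ < 1 → H < t → riemannZeta (σ + t * I) ≠ 0) : _root_.RiemannHypothesis := by
  refine riemannHypothesis_of_forall_riemannHypothesisUpTo_holds fun T s hs h0 _ ↦ ?_
  by_cases hle : s.im ≤ H
  · exact hA s hs h0 hle
  have hIm : H < s.im := lt_of_not_ge hle
  obtain ⟨hs0, hs1⟩ := Literature.NumberTheory.LFunctions.re_mem_Ioo_of_riemannZeta_eq_zero_of_im_ne_zero hs h0.ne'
  rcases lt_trichotomy s.re (1 / 2) with hlt | heq | hgt
  · have hz : riemannZeta (1 - starRingEnd ℂ s) = 0 := by   -- reflection, tree `LevinsonMontgomery.riemannZeta_one_sub_eq_zero`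
      have e1 : 1 - starRingEnd ℂ s = starRingEnd ℂ (1 - s) := by simp
      rw [e1, riemannZeta_conj, LevinsonMontgomery.riemannZeta_one_sub_eq_zero hs0 hs, map_zero]
    have e : (((1 - s.re : ℝ) : ℂ) + ((s.im : ℝ) : ℂ) * I) = 1 - starRingEnd ℂ s := by
      apply Complex.ext <;> simp
    have hz' : riemannZeta (((1 - s.re : ℝ) : ℂ) + ((s.im : ℝ) : ℂ) * I) = 0 := by rw [e]; exact hz
    exact absurd hz' (hB (1 - s.re) s.im (by linarith) (by linarith) hIm)
  · exact heq
  · have hz' : riemannZeta (((s.re : ℝ) : ℂ) + ((s.im : ℝ) : ℂ) * I) = 0 := by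
      rw [Complex.re_add_im]; exact hs
    exact absurd hz' (hB s.re s.im hgt hs1 hIm)

/-! ## §1 Voronin patches -/

/-- The ζ-PATCH at height `t`: `s ↦ ζ(s + 3/4 + it)` on the Voronin discs `|s| ≤ r < 1/4` (normalisation of `Voronin1975_universality`). -/
def patch (t : ℝ) (s : ℂ) : ℂ := riemannZeta (s + 3 / 4 + t * I)

/-- The strip point `σ + it` is the patch value at the real point `s = σ − 3/4`. -/
theorem patch_ofReal_sub (σ t : ℝ) : patch t ((σ - 3 / 4 : ℝ) : ℂ) = riemannZeta (σ + t * I) := by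
  simp only [patch]; congr 1; push_cast; ring

/-- The shifted point as real and imaginary parts. -/
theorem shift_eq (s : ℂ) (t : ℝ) :
    s + 3 / 4 + t * I = ((s.re + 3 / 4 : ℝ) : ℂ) + ((s.im + t : ℝ) : ℂ) * I := by
  apply Complex.ext <;> simp

/-- Patch arguments never hit the pole `s = 1` (`|Re s| ≤ r < 1/4`). -/
theorem shift_ne_one {s : ℂ} {r : ℝ} (hs : ‖s‖ ≤ r) (hr4 : r < 1 / 4) (t : ℝ) : s + 3 / 4 + t * I ≠ 1 := by
  intro h
  have hre := congrArg Complex.re h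
  rw [shift_eq] at hre; simp at hre; linarith [(abs_le.1 ((abs_re_le_norm s).trans hs)).2]

/-- Patches are holomorphic at the points of the closed disc. -/
theorem differentiableAt_patch (t : ℝ) {s : ℂ} {r : ℝ} (hs : ‖s‖ ≤ r) (hr4 : r < 1 / 4) :
    DifferentiableAt ℂ (patch t) s := by
  have hin : DifferentiableAt ℂ (fun z : ℂ ↦ z + 3 / 4 + t * I) s := (differentiableAt_id.add_const _).add_const _
  unfold patch
  exact (differentiableAt_riemannZeta (shift_ne_one hs hr4 t)).comp s hin

/-- Patches are `DiffContOnCl` on the open disc. -/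
theorem diffContOnCl_patch (t : ℝ) {r : ℝ} (hr4 : r < 1 / 4) : DiffContOnCl ℂ (patch t) (ball 0 r) :=
  DifferentiableOn.diffContOnCl_ball (fun _ hs ↦
    (differentiableAt_patch t (mem_closedBall_zero_iff.1 hs) hr4).differentiableWithinAt) Subset.rfl

/-- Joint continuity of `(τ, s) ↦ ζ_τ(s)` on `ℝ × (circle |s| = 1/8)` (the reference LIBRARY over a compact height window is compact). -/
theorem continuous_patch_sphere : Continuous (fun p : ℝ × sphere (0 : ℂ) (1 / 8) ↦ patch p.1 (p.2 : ℂ)) := by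
  have hin : Continuous (fun p : ℝ × sphere (0 : ℂ) (1 / 8) ↦ (p.2 : ℂ) + 3 / 4 + (p.1 : ℂ) * I) :=
    ((continuous_subtype_val.comp continuous_snd).add continuous_const).add
      ((Complex.continuous_ofReal.comp continuous_fst).mul continuous_const)
  refine continuous_iff_continuousAt.2 fun p ↦ ?_
  have hs : ‖(p.2 : ℂ)‖ ≤ 1 / 8 := (mem_sphere_zero_iff_norm.1 p.2.2).le
  have hζ : ContinuousAt riemannZeta ((p.2 : ℂ) + 3 / 4 + (p.1 : ℂ) * I) :=
    (differentiableAt_riemannZeta (shift_ne_one hs (by norm_num) p.1)).continuousAt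
  exact ContinuousAt.comp (f := fun q : ℝ × sphere (0 : ℂ) (1 / 8) ↦ (q.2 : ℂ) + 3 / 4 + (q.1 : ℂ) * I)
    (x := p) hζ hin.continuousAt

/-- A patch whose heights lie in `(0, T]` (`r < τ`, `τ + r ≤ T`) is zero-free on the closed disc when the right half-strip is
zero-free up to `T` — the point where `FIN` (or the descent hypothesis) is CONSUMED, as a certificate about reference values. -/
theorem patch_ne_zero_of_zeroFreeRightUpTo {T r τ : ℝ} (hZ : ZeroFreeRightUpTo T) (hr4 : r < 1 / 4) (hlo : r < τ)
    (hhi : τ + r ≤ T) : ∀ s ∈ closedBall (0 : ℂ) r, patch τ s ≠ 0 := by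
  intro s hs
  have hn : ‖s‖ ≤ r := mem_closedBall_zero_iff.1 hs
  obtain ⟨hre1, hre2⟩ := abs_le.1 ((abs_re_le_norm s).trans hn)
  obtain ⟨him1, him2⟩ := abs_le.1 ((abs_im_le_norm s).trans hn)
  rw [patch, shift_eq]
  exact hZ (s.re + 3 / 4) (s.im + τ) (by linarith) (by linarith) (by linarith) (by linarith)

/-- An abscissa `σ ∈ (1/2, 1)` is the real point `σ − 3/4` of the OPEN disc of radius `(|σ − 3/4| + 1/4)/2 ∈ (0, 1/4)`. -/
theorem exists_radius {σ : ℝ} (h1 : 1 / 2 < σ) (h2 : σ < 1) :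
    ∃ r : ℝ, 0 < r ∧ r < 1 / 4 ∧ ((σ - 3 / 4 : ℝ) : ℂ) ∈ ball (0 : ℂ) r := by
  have hx : |σ - 3 / 4| < 1 / 4 := by rw [abs_lt]; constructor <;> linarith
  refine ⟨(|σ - 3 / 4| + 1 / 4) / 2, by positivity, by linarith, ?_⟩
  rw [mem_ball_zero_iff, Complex.norm_real, Real.norm_eq_abs]; linarith

/-- The real point `r > 0` lies on the circle `|s| = r`. -/
theorem ofReal_mem_sphere {r : ℝ} (hr : 0 < r) : ((r : ℝ) : ℂ) ∈ sphere (0 : ℂ) r := by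
  rw [mem_sphere_zero_iff_norm, Complex.norm_real, Real.norm_eq_abs, abs_of_pos hr]

/-! ## §2 The low-dominant transfer lemma (maximum modulus) -/

/-- **Zero-freeness transfer under boundary domination**: `f, g` holomorphic in `|w − c| < R`, continuous on the closure,
`f ≠ 0` on the CLOSED disc and `‖g − f‖ < ‖f‖` on the circle ⟹ `g ≠ 0` on the closed disc (`φ = (g − f)/f` has `‖φ‖ < 1` on
the compact circle, hence inside by the maximum modulus principle; a zero of `g` would give `φ = −1`). -/
theorem forall_ne_zero_of_norm_sub_lt_norm {f g : ℂ → ℂ} {c : ℂ} {R : ℝ} (hR : 0 < R)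
    (hf : DiffContOnCl ℂ f (ball c R)) (hg : DiffContOnCl ℂ g (ball c R)) (hf0 : ∀ w ∈ closedBall c R, f w ≠ 0)
    (h : ∀ w ∈ sphere c R, ‖g w - f w‖ < ‖f w‖) : ∀ z ∈ closedBall c R, g z ≠ 0 := by
  intro z hz hgz
  have hcl : closure (ball c R) = closedBall c R := closure_ball c hR.ne'
  set φ : ℂ → ℂ := fun w ↦ (g w - f w) / f w with hφ
  have hφd : DiffContOnCl ℂ φ (ball c R) := by
    refine ⟨(hg.differentiableOn.sub hf.differentiableOn).div hf.differentiableOn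
      fun w hw ↦ hf0 w (ball_subset_closedBall hw), ?_⟩
    rw [hcl]
    have hfc : ContinuousOn f (closedBall c R) := hcl ▸ hf.continuousOn
    have hgc : ContinuousOn g (closedBall c R) := hcl ▸ hg.continuousOn
    exact (hgc.sub hfc).div hfc hf0
  have hbound : ∀ w ∈ sphere c R, ‖φ w‖ < 1 := by
    intro w hw
    have hfw : 0 < ‖f w‖ := norm_pos_iff.2 (hf0 w (sphere_subset_closedBall hw))
    show ‖(g w - f w) / f w‖ < 1
    rw [norm_div, div_lt_one hfw]
    exact h w hw
  obtain ⟨w₀, hw₀, hmax⟩ := (isCompact_sphere c R).exists_isMaxOn (NormedSpace.sphere_nonempty.2 hR.le)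
    ((hφd.continuousOn.mono (by rw [hcl]; exact sphere_subset_closedBall)).norm)
  have hC : ∀ w ∈ frontier (ball c R), ‖φ w‖ ≤ ‖φ w₀‖ := by
    rw [frontier_ball c hR.ne']; exact fun w hw ↦ hmax hw
  have hle : ‖φ z‖ ≤ ‖φ w₀‖ :=
    Complex.norm_le_of_forall_mem_frontier_norm_le isBounded_ball hφd hC (by rw [hcl]; exact hz)
  have hval : ‖φ z‖ = 1 := by
    show ‖(g z - f z) / f z‖ = 1
    rw [hgz, zero_sub, norm_div, norm_neg, div_self (norm_ne_zero_iff.2 (hf0 z hz))]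
  linarith [hbound w₀ hw₀]

/-! ## §3 Fixed-window comparability is FALSE (FIN-free): universality versus a compact library -/

/-- **`RoucheFixedLow H W`** (card row N57): every high patch (`t₀ > H`) is LOW-DOMINANT comparable on some circle `|s| = r`,
`0 < r < 1/4`, to a patch of the fixed window (`2r ≤ τ`, `τ + r ≤ W`): `‖ζ_{t₀} − ζ_τ‖ < ‖ζ_τ‖` on the circle. -/
def RoucheFixedLow (H W : ℝ) : Prop :=
  ∀ r : ℝ, 0 < r → r < 1 / 4 → ∀ t₀ : ℝ, H < t₀ →
    ∃ τ : ℝ, 2 * r ≤ τ ∧ τ + r ≤ W ∧ ∀ s ∈ sphere (0 : ℂ) r, ‖patch t₀ s - patch τ s‖ < ‖patch τ s‖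

/-- **`RoucheFixedHigh H W`** (card row N58): the same with the HIGH patch dominant, `‖ζ_τ − ζ_{t₀}‖ < ‖ζ_{t₀}‖` (Rouché proper). -/
def RoucheFixedHigh (H W : ℝ) : Prop :=
  ∀ r : ℝ, 0 < r → r < 1 / 4 → ∀ t₀ : ℝ, H < t₀ →
    ∃ τ : ℝ, 2 * r ≤ τ ∧ τ + r ≤ W ∧ ∀ s ∈ sphere (0 : ℂ) r, ‖patch τ s - patch t₀ s‖ < ‖patch t₀ s‖

/-- Universality (tree theorem `Voronin1975_universality_holds`, positive lower density ⟹ unbounded): above any `T` there is a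
height whose patch is within `ε` of the constant `C > 0` on the closed disc. -/
theorem exists_patch_near_const {r : ℝ} (hr : 0 < r) (hr4 : r < 1 / 4) {C : ℝ} (hC : 0 < C) {ε : ℝ} (hε : 0 < ε)
    (T : ℝ) : ∃ t : ℝ, T < t ∧ ∀ s ∈ closedBall (0 : ℂ) r, ‖patch t s - C‖ < ε := by
  have hV := Voronin1975_universality_holds r hr hr4 (fun _ ↦ (C : ℂ)) continuousOn_const
    (fun _ _ ↦ Complex.ofReal_ne_zero.2 hC.ne') (differentiableOn_const _) ε hε
  obtain ⟨t, ht, htT⟩ := hV.exists_gt T; exact ⟨t, htT, ht⟩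

/-- The fixed window is BOUNDED at the circle point `s = 1/8`: `‖ζ_τ(1/8)‖ ≤ M` for `τ ∈ [1/4, W − 1/8]` (compactness). -/
theorem exists_window_bound (W : ℝ) :
    ∃ M : ℝ, 0 ≤ M ∧ ∀ τ ∈ Icc (2 * (1 / 8 : ℝ)) (W - 1 / 8), ‖patch τ ((1 / 8 : ℝ) : ℂ)‖ ≤ M := by
  have hc : Continuous fun τ : ℝ ↦ patch τ ((⟨_, ofReal_mem_sphere (by norm_num : (0 : ℝ) < 1 / 8)⟩ : sphere (0 : ℂ) (1 / 8)) : ℂ) :=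
    continuous_patch_sphere.comp (Continuous.prodMk_left _)
  obtain ⟨C, hC⟩ := isCompact_Icc.exists_bound_of_continuousOn hc.continuousOn
  exact ⟨max C 0, le_max_right _ _, fun τ hτ ↦ (hC τ hτ).trans (le_max_left _ _)⟩

/-- **N57 is FALSE for every `H, W` (no hypothesis)**: at the circle point `s = 1/8` low-dominance gives
`‖ζ_{t₀}‖ < 2‖ζ_τ‖ ≤ 2M`, against `‖ζ_{t₀}‖ > 2M + 1` for the patches near the constant `2M + 2` that universality supplies. -/
theorem not_roucheFixedLow (H W : ℝ) : ¬ RoucheFixedLow H W := by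
  intro hB
  obtain ⟨M, hM0, hM⟩ := exists_window_bound W
  obtain ⟨t₀, ht₀, hnear⟩ := exists_patch_near_const (r := 1 / 8) (by norm_num) (by norm_num)
    (by linarith : 0 < 2 * M + 2) one_pos H
  obtain ⟨τ, hτ1, hτ2, hdom⟩ := hB (1 / 8) (by norm_num) (by norm_num) t₀ ht₀
  have hs := ofReal_mem_sphere (by norm_num : (0 : ℝ) < 1 / 8)
  have hs' := sphere_subset_closedBall hs
  have hlow : ‖patch τ ((1 / 8 : ℝ) : ℂ)‖ ≤ M := hM τ ⟨hτ1, by linarith⟩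
  have hC : ‖((2 * M + 2 : ℝ) : ℂ)‖ = 2 * M + 2 := by rw [Complex.norm_real, Real.norm_eq_abs, abs_of_pos (by linarith)]
  have h := hnear _ hs'
  rw [norm_sub_rev] at h
  have tri := norm_sub_norm_le ((2 * M + 2 : ℝ) : ℂ) (patch t₀ ((1 / 8 : ℝ) : ℂ))
  have tri2 := norm_sub_norm_le (patch t₀ ((1 / 8 : ℝ) : ℂ)) (patch τ ((1 / 8 : ℝ) : ℂ))
  have hd := hdom _ hs
  linarith

/-- **No patch vanishes on a whole Voronin circle** `|s| = 1/8` (`τ ≥ 1/4`): else it vanishes on the closed disc (maximum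
modulus), hence on the ball `|s| < 7/20` (identity theorem; the pole `1/4 − iτ` is outside since `τ ≥ 1/4`), hence at `s = 3/10`,
where `Re(s + 3/4) = 21/20 ≥ 1` and `ζ ≠ 0` (Mathlib `riemannZeta_ne_zero_of_one_le_re`).  The Euler half-plane supplies ONE
certified non-zero value per patch — no verified window is used. -/
theorem exists_mem_sphere_patch_ne_zero {τ : ℝ} (hτ : 1 / 4 ≤ τ) : ∃ s ∈ sphere (0 : ℂ) (1 / 8), patch τ s ≠ 0 := by
  by_contra h
  push Not at h
  have hr : (0 : ℝ) < 1 / 8 := by norm_num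
  have hr4 : (1 / 8 : ℝ) < 1 / 4 := by norm_num
  have hcl : closure (ball (0 : ℂ) (1 / 8)) = closedBall 0 (1 / 8) := closure_ball 0 hr.ne'
  have hzero : ∀ z ∈ closedBall (0 : ℂ) (1 / 8), patch τ z = 0 := by
    intro z hz
    have hC : ∀ w ∈ frontier (ball (0 : ℂ) (1 / 8)), ‖patch τ w‖ ≤ 0 := by
      rw [frontier_ball 0 hr.ne']
      exact fun w hw ↦ by rw [h w hw, norm_zero]
    exact norm_le_zero_iff.1 (Complex.norm_le_of_forall_mem_frontier_norm_le isBounded_ball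
      (diffContOnCl_patch τ hr4) hC (by rw [hcl]; exact hz))
  have hne : ∀ s ∈ ball (0 : ℂ) (7 / 20), s + 3 / 4 + τ * I ≠ 1 := by
    intro s hs h1
    have hre := congrArg Complex.re h1
    have him := congrArg Complex.im h1
    simp at hre him
    have hn : ‖s‖ < 7 / 20 := mem_ball_zero_iff.1 hs
    have hsq : ‖s‖ ^ 2 = s.re ^ 2 + s.im ^ 2 := by rw [Complex.sq_norm, Complex.normSq_apply]; ring
    have h49 : ‖s‖ ^ 2 < 49 / 400 := by nlinarith [norm_nonneg s]
    rw [hsq, (by linarith : s.re = 1 / 4), (by linarith : s.im = -τ)] at h49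
    nlinarith
  have hd : DifferentiableOn ℂ (patch τ) (ball (0 : ℂ) (7 / 20)) := by
    intro s hs
    have hin : DifferentiableAt ℂ (fun z : ℂ ↦ z + 3 / 4 + τ * I) s := (differentiableAt_id.add_const _).add_const _
    unfold patch
    exact ((differentiableAt_riemannZeta (hne s hs)).comp s hin).differentiableWithinAt
  have hEq : EqOn (patch τ) 0 (ball (0 : ℂ) (7 / 20)) :=
    (hd.analyticOnNhd isOpen_ball).eqOn_zero_of_preconnected_of_eventuallyEq_zero
      (convex_ball (0 : ℂ) (7 / 20)).isPreconnected (mem_ball_self (by norm_num))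
      (by filter_upwards [closedBall_mem_nhds (0 : ℂ) hr] with z hz using hzero z hz)
  have h3 : ((3 / 10 : ℝ) : ℂ) ∈ ball (0 : ℂ) (7 / 20) := by
    rw [mem_ball_zero_iff, Complex.norm_real, Real.norm_eq_abs, abs_of_pos (by norm_num)]
    norm_num
  have hre1 : (1 : ℝ) ≤ (((3 / 10 : ℝ) : ℂ) + 3 / 4 + τ * I).re := by simp; norm_num
  exact riemannZeta_ne_zero_of_one_le_re hre1 (hEq h3)

/-- **Uniform circle size of the window, FIN-free**: some `m > 0` such that EVERY patch of the window `τ ∈ [1/4, W − 1/8]` has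
modulus `≥ m` SOMEWHERE on `|s| = 1/8` (`τ ↦ max_circle ‖ζ_τ‖` is continuous by `IsCompact.continuous_sSup`, positive by
`exists_mem_sphere_patch_ne_zero`, so it has a positive minimum on the compact window). -/
theorem exists_uniform_circle_size {W : ℝ} (hK : 2 * (1 / 8 : ℝ) ≤ W - 1 / 8) :
    ∃ m : ℝ, 0 < m ∧ ∀ τ ∈ Icc (2 * (1 / 8 : ℝ)) (W - 1 / 8), ∃ s ∈ sphere (0 : ℂ) (1 / 8), m ≤ ‖patch τ s‖ := by
  set F : ℝ → sphere (0 : ℂ) (1 / 8) → ℝ := fun τ s ↦ ‖patch τ (s : ℂ)‖ with hF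
  have hFc : Continuous ↿F := continuous_patch_sphere.norm
  set g : ℝ → ℝ := fun τ ↦ sSup (F τ '' univ) with hg
  have hgc : Continuous g := isCompact_univ.continuous_sSup hFc
  have hune : (univ : Set (sphere (0 : ℂ) (1 / 8))).Nonempty := ⟨⟨_, ofReal_mem_sphere (by norm_num)⟩, mem_univ _⟩
  have hatt : ∀ τ : ℝ, ∃ s₁ : sphere (0 : ℂ) (1 / 8), g τ ≤ F τ s₁ ∧ ∀ s, F τ s ≤ F τ s₁ := by
    intro τ
    obtain ⟨s₁, -, hmax⟩ := isCompact_univ.exists_isMaxOn hune (hFc.comp (Continuous.prodMk_right τ)).continuousOn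
    have hmax' : ∀ s, F τ s ≤ F τ s₁ := fun s ↦ hmax (mem_univ s)
    refine ⟨s₁, csSup_le (hune.image _) ?_, hmax'⟩
    rintro _ ⟨s, -, rfl⟩
    exact hmax' s
  have hgpos : ∀ τ : ℝ, 1 / 4 ≤ τ → 0 < g τ := by
    intro τ hτ
    obtain ⟨s₀, hs₀, hne⟩ := exists_mem_sphere_patch_ne_zero hτ
    obtain ⟨s₁, -, hmax⟩ := hatt τ
    have hbdd : BddAbove (F τ '' univ) := ⟨F τ s₁, by rintro _ ⟨s, -, rfl⟩; exact hmax s⟩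
    have hle : F τ ⟨s₀, hs₀⟩ ≤ g τ := le_csSup hbdd (mem_image_of_mem _ (mem_univ _))
    have hp : 0 < F τ ⟨s₀, hs₀⟩ := norm_pos_iff.2 hne
    linarith
  obtain ⟨τ₀, hτ₀, hmin⟩ := isCompact_Icc.exists_isMinOn (nonempty_Icc.2 hK) hgc.continuousOn
  refine ⟨g τ₀, hgpos τ₀ (by linarith [(mem_Icc.1 hτ₀).1]), fun τ hτ ↦ ?_⟩
  obtain ⟨s₁, hs₁, -⟩ := hatt τ
  exact ⟨(s₁ : ℂ), s₁.2, (hmin hτ).trans hs₁⟩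

/-- **N58 is FALSE for every `H, W` (no hypothesis)**: universality with the constant target `m/4` gives, above every height,
a patch of modulus `< 3m/8` on the disc; high-dominance would force `‖ζ_τ‖ < 2‖ζ_{t₀}‖ < 3m/4` on the WHOLE circle, but every
window patch reaches `m` somewhere on it. -/
theorem not_roucheFixedHigh (H W : ℝ) : ¬ RoucheFixedHigh H W := by
  intro hB
  by_cases hK : 2 * (1 / 8 : ℝ) ≤ W - 1 / 8
  · obtain ⟨m, hm, hsize⟩ := exists_uniform_circle_size hK
    obtain ⟨t₀, ht₀, hnear⟩ :=
      exists_patch_near_const (r := 1 / 8) (by norm_num) (by norm_num) (by positivity : 0 < m / 4) (by positivity : 0 < m / 8) H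
    obtain ⟨τ, hτ1, hτ2, hdom⟩ := hB (1 / 8) (by norm_num) (by norm_num) t₀ ht₀
    obtain ⟨s₁, hs₁, hbig⟩ := hsize τ ⟨hτ1, by linarith⟩
    have hC : ‖((m / 4 : ℝ) : ℂ)‖ = m / 4 := by rw [Complex.norm_real, Real.norm_eq_abs, abs_of_pos (by positivity)]
    have h := hnear _ (sphere_subset_closedBall hs₁)
    have tri := norm_sub_norm_le (patch t₀ s₁) (((m / 4 : ℝ) : ℂ))
    have tri2 := norm_sub_norm_le (patch τ s₁) (patch t₀ s₁)
    have hd := hdom _ hs₁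
    linarith
  · obtain ⟨τ, hτ1, hτ2, -⟩ := hB (1 / 8) (by norm_num) (by norm_num) (H + 1) (by linarith)
    exact hK (hτ1.trans (by linarith))

/-! ## §4 Half-height comparability SPLITS RH with `FIN` by descent -/

/-- **`RoucheHalfLow H`** (card row N61a): every high patch (`t₀ > H`) is low-dominant comparable on the circle `|s| = r`,
`0 < r < 1/4`, to a patch at AT MOST HALF ITS HEIGHT (`2r ≤ τ`, `τ + r ≤ t₀/2`).  The reference library co-grows with `t₀`
and bottoms out in the verified window; NOT refuted, NOT known to follow from RH (banked residue of the card). -/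
def RoucheHalfLow (H : ℝ) : Prop :=
  ∀ r : ℝ, 0 < r → r < 1 / 4 → ∀ t₀ : ℝ, H < t₀ →
    ∃ τ : ℝ, 2 * r ≤ τ ∧ τ + r ≤ t₀ / 2 ∧ ∀ s ∈ sphere (0 : ℂ) r, ‖patch t₀ s - patch τ s‖ < ‖patch τ s‖

/-- **`HalfTransfer H`** — the value-free DESCENT LAW: above `H`, a zero-free right half-strip up to `t/2` excludes zeros at
height `t`.  (RH-implied, hence RH-EQUIVALENT given `FIN`: `halfTransfer_iff_rh`.) -/
def HalfTransfer (H : ℝ) : Prop :=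
  ∀ σ t : ℝ, 1 / 2 < σ → σ < 1 → H < t → ZeroFreeRightUpTo (t / 2) → riemannZeta (σ + t * I) ≠ 0

/-- Half-height low-dominant comparability gives the descent law (one maximum-modulus comparison per point). -/
theorem halfTransfer_of_roucheHalfLow {H : ℝ} (hB : RoucheHalfLow H) : HalfTransfer H := by
  intro σ t h1 h2 ht hZ
  obtain ⟨r, hr, hr4, hmem⟩ := exists_radius h1 h2
  obtain ⟨τ, hτ1, hτ2, hdom⟩ := hB r hr hr4 t ht
  have hτ0 := patch_ne_zero_of_zeroFreeRightUpTo hZ hr4 (by linarith) hτ2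
  rw [← patch_ofReal_sub]
  exact forall_ne_zero_of_norm_sub_lt_norm hr (diffContOnCl_patch τ hr4) (diffContOnCl_patch t hr4) hτ0 hdom _
    (ball_subset_closedBall hmem)

/-- DESCENT: `FIN` and the descent law give the right half-strip zero-free up to `2^k · H₀` for every `k`
(base `k = 0` is `FIN`; the step certifies heights in `(2^k H₀, 2^{k+1} H₀]` from the library below `2^k H₀`). -/
theorem zeroFreeRightUpTo_two_pow (hA : riemannHypothesisUpTo_platt_trudgian) (hB : HalfTransfer 3000175332800)
    (k : ℕ) : ZeroFreeRightUpTo (2 ^ k * 3000175332800) := by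
  induction k with
  | zero => simpa using zeroFreeRightUpTo_of_rhUpTo hA
  | succ k ih =>
    intro σ t h1 h2 ht htk
    by_cases hle : t ≤ 2 ^ k * 3000175332800
    · exact ih σ t h1 h2 ht hle
    · have hgt : 2 ^ k * 3000175332800 < t := lt_of_not_ge hle
      have hk1 : (1 : ℝ) ≤ 2 ^ k := one_le_pow₀ (by norm_num)
      refine hB σ t h1 h2 (by nlinarith) fun σ' t' h1' h2' ht' ht'2 ↦ ih σ' t' h1' h2' ht' ?_
      rw [pow_succ] at htk; linarith

/-- `FIN ∧ HalfTransfer H₀ ⟹ RH`. -/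
theorem rh_of_fin_of_halfTransfer (hA : riemannHypothesisUpTo_platt_trudgian) (hB : HalfTransfer 3000175332800) :
    _root_.RiemannHypothesis := by
  refine rh_of_rhUpTo_of_zeroFreeRight hA fun σ t h1 h2 ht ↦ ?_
  obtain ⟨k, hk⟩ := pow_unbounded_of_one_lt (t / 3000175332800) (by norm_num : (1 : ℝ) < 2)
  exact zeroFreeRightUpTo_two_pow hA hB k σ t h1 h2 (by linarith)
    (by rw [div_lt_iff₀ (by norm_num)] at hk; exact hk.le)

/-- **THE SPLITTING (N61a)**: `FIN ∧ RoucheHalfLow H₀ ⟹ RH` — `FIN` consumed as the base layer of a self-certifying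
comparison tower, with no count and no density estimate. -/
theorem rh_of_fin_of_roucheHalfLow (hA : riemannHypothesisUpTo_platt_trudgian) (hB : RoucheHalfLow 3000175332800) :
    _root_.RiemannHypothesis :=
  rh_of_fin_of_halfTransfer hA (halfTransfer_of_roucheHalfLow hB)

/-- The value-free law is RH-implied (immune as a refutation target). -/
theorem halfTransfer_of_rh (hRH : _root_.RiemannHypothesis) {H : ℝ} (hH : 0 ≤ H) : HalfTransfer H := by
  intro σ t h1 _ ht _ hz
  have := RiemannHypothesisUpTo.of_riemannHypothesis hRH t _ hz (by simpa using hH.trans_lt ht) (by simp)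
  simp at this; linarith

/-- Given `FIN`, the descent law is RH-EQUIVALENT. -/
theorem halfTransfer_iff_rh (hA : riemannHypothesisUpTo_platt_trudgian) :
    HalfTransfer 3000175332800 ↔ _root_.RiemannHypothesis :=
  ⟨rh_of_fin_of_halfTransfer hA, fun h ↦ halfTransfer_of_rh h (by norm_num)⟩

end Summit.RiemannHypothesis.RiemannHypothesis.Theorems.Splittings.ZdValueLibrary

end
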